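import Literature.Analysis.Calculus.ParametricTransversality
import Literature.Topology.FourManifolds.CerfPathJets
import Literature.Topology.FourManifolds.InjectiveLinearMapsSimplyConnected
import Mathlib.Analysis.Calculus.FDeriv.CompCLM
import Mathlib.Analysis.Calculus.ContDiff.Operations
import Mathlib.Analysis.Normed.Module.HahnBanach
import Mathlib.MeasureTheory.Constructions.Pi
import Mathlib.MeasureTheory.Measure.Haar.OfBasis
import Mathlib.MeasureTheory.Constructions.BorelSpace.ContinuousLinearMap
import Mathlib.Topology.Algebra.Module.FiniteDimension
import HarnessLib

/-!
# First-order genericity of smooth maps (Thom): after almost every linear perturbation the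
# differential vanishes nowhere and the 1-jet is transverse to the corank strata

Topic `Literature/Topology/FourManifolds` (programme of the fact
`Literature.Topology.FourManifolds.exists_isSimplifiedBrokenLefschetzFibration`, Baykur–Saeki 2017,
Thm. 6.1 / Cor. 6.2, whose printed proof STARTS from a generic map `X⁴ → S²`: *"A special case of
Thom's transversality implies that any smooth map from an `n ≥ 2` dimensional space to a surface
can be approximated arbitrarily well by a map with only fold and cusp singularities [Lev0, T, Wh].
Such `f : X → Σ` is called a generic map"* (arXiv:1705.11169, §2.1, p. 6)).  The first layer of
that genericity is first order — the behaviour of the 1-jet `x ↦ df_x` against the corank strata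
`S_r ⊆ Hom(T_x X, T_y Y)` (Golubitsky–Guillemin, *Stable Mappings and Their Singularities* (1973),
Ch. II §4, Thm. 4.9 (Thom Transversality Theorem); Ch. VI §1: *"generically `S_r(f)` is a
submanifold of `X` and codim `S_r(f) = codim S_r = r² + er` […] This statement follows immediately
from the Thom Transversality Theorem"*, Def. 1.5: *"a mapping `f : X → Y` is one generic if
`j¹f ⋔ S_r` for all `r`"*; Ch. VI §3, (3.1), Lemma 3.2, Cor. 3.4 and Props. 3.6–3.7: the normal
space of `S_r` at `A` is `Hom(Ker A, coker A)` by "restricting and projecting", so that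
`j¹f ⋔ S_r` at `x` iff the intrinsic derivative `T_x X → Hom(K_x, L_x)`,
`v ↦ [k ↦ D²f(x)(v, k) mod Im df_x]`, is onto).

This file PROVES that layer in the finite-dimensional, measure-theoretic (Sard) form in which the
tree consumes Thom's theorems (as in the Cerf programme, `CerfExcellentPaths.lean`), for a `C^∞`
map `f : E ⊇ Ω → F` between finite-dimensional real normed spaces and the family of its
perturbations `f + ∑ pᵢ wᵢ` by finitely many `C^∞` directions `wᵢ` whose differentials span
`Hom(E, F)` at every point of `Ω` (e.g. all linear maps; or, in a chart of a manifold embedded in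
`ℝᴺ`, the coordinate functions times constant vectors):

* `OneJet.perturb f w p = f + ∑ pᵢ wᵢ` and its calculus (`hasFDerivAt_perturb`,
  `contDiffOn_fderiv_perturb`, `hasFDerivAt_fderiv_perturb_param`);
* `OneJet.IsOneJetTransverseAt g x` — the transversality of `j¹g` to the corank strata at `x`,
  read on covectors: for every non-zero `ℓ ∈ F*` killing `Im dg_x`, the pairing
  `(v, k) ↦ ℓ(D²g(x)(v, k))` on `E × Ker dg_x` is nondegenerate in `k`.  When
  `coker dg_x` is a line (maps to the plane at a critical point of rank one — the case of
  generic maps `X⁴ → Σ²`) this is exactly Golubitsky–Guillemin's criterion VI.3.7, the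
  surjectivity of `v ↦ ℓ ∘ D²g(x)(v, ·)|_{Ker dg_x}` onto `(Ker dg_x)*` being equivalent, in
  finite dimension, to the injectivity of the transposed pairing on `Ker dg_x`
  (`isOneJetTransverseAt_iff_injOn`, `pairing`);
* `OneJet.ae_fderiv_perturb_ne_zero` — **for a.e. `p` the differential of `f + ∑ pᵢ wᵢ`
  vanishes nowhere on `Ω`** when `dim E < dim Hom(E, F)` (the stratum `{0} = S_q` has
  codimension `dim Hom(E,F) > dim E` and is missed: Thom's theorem by the dimension count,
  GG II.4.9 with VI.1.1);
* `OneJet.ae_isOneJetTransverseAt_perturb` — **for a.e. `p`, `f + ∑ pᵢ wᵢ` is 1-jet-transverse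
  at every point of `Ω`** (GG VI, Def. 1.5 with Prop. 3.7).  Proof: parametric transversality
  (`Literature.Analysis.Calculus.ParametricTransversality.ae_surjective_fderiv_section`, Sard)
  for the incidence map `G(p, x, ℓ) = ℓ ∘ d(f + ∑ pᵢwᵢ)_x ∈ E*` on `Ω × (F* ∖ 0)` — the dual of
  Golubitsky–Guillemin's Grassmannian description `L⁰(Q, W) ≅ Lʳ(V, W)` of the strata (VI, (1.2),
  Prop. 1.4): `∂_pG` is onto because `ℓ ≠ 0` and the `dwᵢ` span, and at a zero the ontoness of
  `∂_{(x,ℓ)}G (v, λ) = ℓ ∘ D²g(x)(v, ·) + λ ∘ dg_x` forces every `k ∈ Ker dg_x` paired to zero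
  with all `v` to be killed by every covector, hence to vanish (Hahn–Banach);
* `OneJet.ae_oneGeneric_add` — the headline form: **for almost every linear map `A`** (any
  additive Haar measure on `Hom(E, F)`), **`f + A` has nowhere-vanishing differential and is
  1-jet-transverse on `Ω`**; `OneJet.exists_opNorm_lt_oneGeneric` — such `A` exist with
  `‖A‖ < ε`;
* the numerology of the case of interest, maps from 4-space to the plane
  (`finrank_euclideanFour_lt`), and `OneJet.exists_opNorm_lt_oneGeneric_four_two`.

Everything here is proved; the two definitions (`perturb`, `IsOneJetTransverseAt`) carry their
unfolding lemmas; no named fact is introduced (D-0026).  Deliberately NOT here: the second-order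
layer (a.e. the non-fold critical points are nondegenerate cusps, GG VI §4 / Levine), the
submanifold structure of `S₁(f)` and the passage to compact manifolds by charts — the next bricks
of the same programme; the fold NORMAL FORM at a 1-jet-transverse critical point with nondegenerate
indefinite kernel Hessian is already the tree's
`Literature.Topology.FourManifolds.hasIndefiniteFoldChart_of_kerHessian`.

## References

* M. Golubitsky, V. Guillemin, *Stable Mappings and Their Singularities*, GTM 14, Springer (1973):
  Ch. II §4, Thm. 4.9, Cor. 4.10; Ch. II §5, Prop. 5.3; Ch. VI §1, Prop. 1.1, (1.2), Prop. 1.4,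
  Def. 1.5; Ch. VI §3, (3.1), Lemma 3.2, Cor. 3.4, Props. 3.6, 3.7; Ch. III §4, Def. 4.1.
  [GolubitskyGuillemin1973]
* M. W. Hirsch, *Differential Topology*, GTM 33 (1976), Ch. 3 §2, Thm. 2.7 (parametric
  transversality). [HirschDT1976]
* R. İ. Baykur, O. Saeki, *Simplifying indefinite fibrations on 4-manifolds*, arXiv:1705.11169,
  §2.1, p. 6. [BaykurSaeki2017]
* H. I. Levine, *Singularities of differentiable mappings* (notes of lectures by R. Thom),
  Proc. Liverpool Singularities Symposium I, LNM 192 (1971), 1–89 (B–S's [Lev0]); R. Thom, *Les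
  singularités des applications différentiables*, Ann. Inst. Fourier 6 (1955–56), 43–87;
  H. Whitney, *On singularities of mappings of euclidean spaces. I*, Ann. of Math. 62 (1955),
  374–410.
-/

noncomputable section

open Set Function Filter MeasureTheory Module
open scoped ContDiff Topology BigOperators

namespace Literature.Topology.FourManifolds

namespace OneJet

open Literature.Analysis.Calculus Literature.Analysis.Calculus.ParametricTransversality
open Literature.Topology.FourManifolds.CerfPath (lin lin_apply hasFDerivAt_const_add_sum_smul)

/-! ### The perturbed family `f + ∑ pᵢ wᵢ` and its first-order calculus -/

section Defs

variable {E F : Type} [NormedAddCommGroup F] [NormedSpace ℝ F] {ι : Type} [Fintype ι]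

/-- The finite-dimensional family of perturbations `f + ∑ᵢ pᵢ wᵢ` of a map `f : E → F` by the
directions `wᵢ : E → F` (the shadow of Thom's set-up in which the tree applies Sard's theorem;
cf. `CerfPath.perturb` for real functions). [cite: GolubitskyGuillemin1973, Ch. II §4, proof of Thm. 4.9] -/
def perturb (f : E → F) (w : ι → E → F) (p : ι → ℝ) : E → F :=
  fun x => f x + ∑ i, p i • w i x

/-- Unfolding `perturb`. [folklore] -/
@[simp]
theorem perturb_apply (f : E → F) (w : ι → E → F) (p : ι → ℝ) (x : E) :
    perturb f w p x = f x + ∑ i, p i • w i x :=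
  rfl

end Defs

section Calculus

variable {E F : Type} [NormedAddCommGroup E] [NormedSpace ℝ E]
  [NormedAddCommGroup F] [NormedSpace ℝ F] {ι : Type} [Fintype ι]

/-- The differential of the perturbed map: `d(f + ∑ pᵢ wᵢ)_x = df_x + ∑ pᵢ (dwᵢ)_x`. [folklore] -/
theorem hasFDerivAt_perturb {f : E → F} {w : ι → E → F} {x : E} (hf : DifferentiableAt ℝ f x)
    (hw : ∀ i, DifferentiableAt ℝ (w i) x) (p : ι → ℝ) :
    HasFDerivAt (perturb f w p) (fderiv ℝ f x + ∑ i, p i • fderiv ℝ (w i) x) x := by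
  unfold perturb
  exact hf.hasFDerivAt.add (HasFDerivAt.fun_sum fun i _ => (hw i).hasFDerivAt.const_smul (p i))

/-- `fderiv` of the perturbed map at a point of differentiability. [folklore] -/
theorem fderiv_perturb {f : E → F} {w : ι → E → F} {x : E} (hf : DifferentiableAt ℝ f x)
    (hw : ∀ i, DifferentiableAt ℝ (w i) x) (p : ι → ℝ) :
    fderiv ℝ (perturb f w p) x = fderiv ℝ f x + ∑ i, p i • fderiv ℝ (w i) x :=
  (hasFDerivAt_perturb hf hw p).fderiv

/-- On an open set where the data are `C^∞`, `fderiv (f + ∑ pᵢ wᵢ) = fderiv f + ∑ pᵢ fderiv wᵢ`.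
[folklore] -/
theorem fderiv_perturb_of_mem {f : E → F} {w : ι → E → F} {Ω : Set E} (hΩ : IsOpen Ω)
    (hf : ContDiffOn ℝ ∞ f Ω) (hw : ∀ i, ContDiffOn ℝ ∞ (w i) Ω) (p : ι → ℝ) {x : E}
    (hx : x ∈ Ω) :
    fderiv ℝ (perturb f w p) x = fderiv ℝ f x + ∑ i, p i • fderiv ℝ (w i) x :=
  fderiv_perturb ((hf.contDiffAt (hΩ.mem_nhds hx)).differentiableAt (by simp))
    (fun i => ((hw i).contDiffAt (hΩ.mem_nhds hx)).differentiableAt (by simp)) p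

/-- The perturbed map is `C^∞` on `Ω` when the data are. [folklore] -/
theorem contDiffOn_perturb {f : E → F} {w : ι → E → F} {Ω : Set E}
    (hf : ContDiffOn ℝ ∞ f Ω) (hw : ∀ i, ContDiffOn ℝ ∞ (w i) Ω) (p : ι → ℝ) :
    ContDiffOn ℝ ∞ (perturb f w p) Ω := by
  unfold perturb
  exact hf.add (ContDiffOn.sum fun i _ => contDiffOn_const.smul (hw i))

/-- **The 1-jet of the perturbed family is jointly `C^∞` in `(p, x)`** on `ℝᵐ × Ω`. [folklore] -/
theorem contDiffOn_fderiv_perturb {f : E → F} {w : ι → E → F} {Ω : Set E} (hΩ : IsOpen Ω)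
    (hf : ContDiffOn ℝ ∞ f Ω) (hw : ∀ i, ContDiffOn ℝ ∞ (w i) Ω) :
    ContDiffOn ℝ ∞ (fun px : (ι → ℝ) × E => fderiv ℝ (perturb f w px.1) px.2) (univ ×ˢ Ω) := by
  have hf' : ContDiffOn ℝ ∞ (fderiv ℝ f) Ω := hf.fderiv_of_isOpen hΩ (by simp)
  have hw' : ∀ i, ContDiffOn ℝ ∞ (fderiv ℝ (w i)) Ω := fun i => (hw i).fderiv_of_isOpen hΩ (by simp)
  have heq : ∀ px ∈ (univ : Set (ι → ℝ)) ×ˢ Ω, fderiv ℝ (perturb f w px.1) px.2 =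
      fderiv ℝ f px.2 + ∑ i, px.1 i • fderiv ℝ (w i) px.2 := fun px hpx =>
    fderiv_perturb_of_mem hΩ hf hw px.1 hpx.2
  refine ContDiffOn.congr ?_ heq
  have hsnd : MapsTo (Prod.snd : (ι → ℝ) × E → E) (univ ×ˢ Ω) Ω := fun px hpx => hpx.2
  refine (hf'.comp contDiffOn_snd hsnd).add (ContDiffOn.sum fun i _ => ?_)
  exact (((contDiff_apply ℝ ℝ i).comp contDiff_fst).contDiffOn).smul
    ((hw' i).comp contDiffOn_snd hsnd)

/-- **The 1-jet of the perturbed family is affine in the parameter**, with derivative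
`ṗ ↦ ∑ ṗᵢ (dwᵢ)_x` (`CerfPath.lin`). [folklore] -/
theorem hasFDerivAt_fderiv_perturb_param {f : E → F} {w : ι → E → F} {Ω : Set E} (hΩ : IsOpen Ω)
    (hf : ContDiffOn ℝ ∞ f Ω) (hw : ∀ i, ContDiffOn ℝ ∞ (w i) Ω) {x : E} (hx : x ∈ Ω)
    (p : ι → ℝ) :
    HasFDerivAt (fun q : ι → ℝ => fderiv ℝ (perturb f w q) x)
      (lin fun i => fderiv ℝ (w i) x) p := by
  have heq : (fun q : ι → ℝ => fderiv ℝ (perturb f w q) x) =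
      fun q => fderiv ℝ f x + ∑ i, q i • fderiv ℝ (w i) x := by
    funext q; exact fderiv_perturb_of_mem hΩ hf hw q hx
  rw [heq]
  exact hasFDerivAt_const_add_sum_smul (fderiv ℝ f x) (fun i => fderiv ℝ (w i) x) p

/-! ### Transversality of the 1-jet to the corank strata, on covectors -/

/-- **`g` is 1-jet-transverse at `x`** (the covector reading of `j¹g ⋔ S_r` at `x`,
Golubitsky–Guillemin 1973, Ch. VI, Def. 1.5 with §3, Prop. 3.7): for every non-zero covector `ℓ`
of `F` vanishing on `Im dg_x`, a vector `k ∈ Ker dg_x` with `ℓ(D²g(x)(v, k)) = 0` for ALL `v ∈ E`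
is zero — i.e. the map `v ↦ ℓ ∘ D²g(x)(v, ·)|_{Ker dg_x}` ("restricting and projecting" the
2-jet, GG VI (3.1)) is onto `(Ker dg_x)*`.  When `coker dg_x` is one-dimensional (a critical
point of rank `dim F - 1`, e.g. any critical point of rank one of a map to the plane) `ℓ` is
unique up to scale and this IS the surjectivity of the intrinsic derivative
`T_x E → Hom(Ker dg_x, coker dg_x)`, GG VI Prop. 3.7 (b) ⇔ (a); in general it is its shadow on
each line of the cokernel.  Vacuous at regular points (no such `ℓ`).
[cite: GolubitskyGuillemin1973, Ch. VI §1, Def. 1.5; §3, (3.1), Lemma 3.2, Cor. 3.4, Prop. 3.7] -/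
def IsOneJetTransverseAt (g : E → F) (x : E) : Prop :=
  ∀ ℓ : F →L[ℝ] ℝ, ℓ ≠ 0 → ℓ.comp (fderiv ℝ g x) = 0 →
    ∀ k : E, fderiv ℝ g x k = 0 → (∀ v : E, ℓ (fderiv ℝ (fderiv ℝ g) x v k) = 0) → k = 0

/-- Unfolding `IsOneJetTransverseAt`. [folklore] -/
theorem isOneJetTransverseAt_iff (g : E → F) (x : E) :
    IsOneJetTransverseAt g x ↔ ∀ ℓ : F →L[ℝ] ℝ, ℓ ≠ 0 → ℓ.comp (fderiv ℝ g x) = 0 →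
      ∀ k : E, fderiv ℝ g x k = 0 → (∀ v : E, ℓ (fderiv ℝ (fderiv ℝ g) x v k) = 0) → k = 0 :=
  Iff.rfl

/-- A regular point (onto differential) is 1-jet-transverse: no non-zero covector kills the image.
[cite: GolubitskyGuillemin1973, Ch. VI §1, Def. 1.5] -/
theorem isOneJetTransverseAt_of_surjective {g : E → F} {x : E}
    (h : Surjective (fderiv ℝ g x)) : IsOneJetTransverseAt g x := by
  intro ℓ hℓ hcomp
  exfalso
  apply hℓ
  ext y
  obtain ⟨v, rfl⟩ := h y
  simpa using congrArg (fun φ : E →L[ℝ] ℝ => φ v) hcomp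

/-- The pairing `(v, k) ↦ ℓ(D²g(x)(v, k))`, as a linear map `k ↦ (v ↦ ℓ(D²g(x)(v, k)))` from
`E` to its dual (GG's "restricting and projecting" map VI (3.1) composed with `ℓ`, transposed).
[cite: GolubitskyGuillemin1973, Ch. VI §3, (3.1)] -/
def pairing (ℓ : F →L[ℝ] ℝ) (g : E → F) (x : E) : E →ₗ[ℝ] (E →L[ℝ] ℝ) where
  toFun k := ℓ.comp ((fderiv ℝ (fderiv ℝ g) x).flip k)
  map_add' k k' := by ext v; simp
  map_smul' c k := by ext v; simp

/-- `pairing ℓ g x k v = ℓ (D²g(x) v k)`. [folklore] -/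
@[simp]
theorem pairing_apply (ℓ : F →L[ℝ] ℝ) (g : E → F) (x : E) (k v : E) :
    pairing ℓ g x k v = ℓ (fderiv ℝ (fderiv ℝ g) x v k) := by
  simp [pairing]

/-- **Equivalence with Golubitsky–Guillemin's criterion** (VI, Prop. 3.7): `g` is
1-jet-transverse at `x` iff for every non-zero covector `ℓ` killing `Im dg_x` the restriction of
the pairing `k ↦ ℓ ∘ D²g(x)(·, k)` to `Ker dg_x` is injective — equivalently (finite dimension,
the image having dimension `dim Ker dg_x`) "restricting and projecting the 2-jet",
`v ↦ ℓ ∘ D²g(x)(v, ·)|_{Ker dg_x}`, is onto the dual of the kernel.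
[cite: GolubitskyGuillemin1973, Ch. VI §3, Prop. 3.7] -/
theorem isOneJetTransverseAt_iff_injOn (g : E → F) (x : E) :
    IsOneJetTransverseAt g x ↔ ∀ ℓ : F →L[ℝ] ℝ, ℓ ≠ 0 → ℓ.comp (fderiv ℝ g x) = 0 →
      InjOn (pairing ℓ g x) (LinearMap.ker (fderiv ℝ g x : E →ₗ[ℝ] F)) := by
  constructor
  · -- a linear map is injective on a submodule iff its kernel there is trivial
    intro h ℓ hℓ hcomp k hk k' hk' hkk
    have hsub : pairing ℓ g x (k - k') = 0 := by rw [map_sub, hkk, sub_self]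
    have hmem : fderiv ℝ g x (k - k') = 0 := by
      have hk0 : fderiv ℝ g x k = 0 := hk
      have hk0' : fderiv ℝ g x k' = 0 := hk'
      rw [map_sub, hk0, hk0', sub_self]
    have := h ℓ hℓ hcomp (k - k') hmem fun v => by
      simpa using congrArg (fun φ : E →L[ℝ] ℝ => φ v) hsub
    exact sub_eq_zero.1 this
  · intro h ℓ hℓ hcomp k hk hv
    have hk' : k ∈ (LinearMap.ker (fderiv ℝ g x : E →ₗ[ℝ] F) : Set E) := hk
    have h0 : (0 : E) ∈ (LinearMap.ker (fderiv ℝ g x : E →ₗ[ℝ] F) : Set E) := by simp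
    refine h ℓ hℓ hcomp hk' h0 ?_
    rw [map_zero]
    ext v
    simpa using hv v

/-- **The linear algebra of the incidence map.**  If the map
`(v, λ) ↦ ℓ ∘ D²g(x)(v, ·) + λ ∘ dg_x : E × F* → E*` is onto, then every `k ∈ Ker dg_x` paired
to zero with all `v` is zero: every covector of `E` is of the form `ℓ ∘ D²g(x)(v, ·) + λ ∘ dg_x`
and kills such a `k`, so `k = 0` by Hahn–Banach.
[cite: GolubitskyGuillemin1973, Ch. VI §3, Lemma 3.2 and Prop. 3.7] -/
theorem eq_zero_of_surjective_incidence {g : E → F} {x : E} {ℓ : F →L[ℝ] ℝ}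
    (hT : Surjective fun vl : E × (F →L[ℝ] ℝ) =>
      ℓ.comp (fderiv ℝ (fderiv ℝ g) x vl.1) + vl.2.comp (fderiv ℝ g x))
    {k : E} (hk : fderiv ℝ g x k = 0) (hv : ∀ v : E, ℓ (fderiv ℝ (fderiv ℝ g) x v k) = 0) :
    k = 0 := by
  by_contra hk0
  obtain ⟨φ, -, hφ⟩ := exists_dual_vector ℝ k (norm_ne_zero_iff.2 hk0)
  obtain ⟨⟨v, lam⟩, hvl⟩ := hT φ
  have h1 : (ℓ.comp (fderiv ℝ (fderiv ℝ g) x v) + lam.comp (fderiv ℝ g x)) k = φ k := by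
    have := congrArg (fun ψ : E →L[ℝ] ℝ => ψ k) hvl
    simpa only using this
  have h2 : φ k = 0 := by
    rw [← h1, _root_.add_apply, ContinuousLinearMap.comp_apply, ContinuousLinearMap.comp_apply, hk,
      hv v, map_zero, add_zero]
  have h3 : (φ k : ℝ) = ‖k‖ := by simpa using hφ
  exact hk0 (norm_eq_zero.1 (h3 ▸ h2))

/-- A non-zero covector takes the value `1`. [folklore] -/
theorem exists_apply_eq_one {ℓ : F →L[ℝ] ℝ} (hℓ : ℓ ≠ 0) : ∃ u : F, ℓ u = 1 := by
  have h : ¬ ∀ u : F, ℓ u = 0 := fun h =>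
    hℓ (ContinuousLinearMap.ext fun u => by simpa using h u)
  obtain ⟨u₀, hu₀⟩ := not_forall.1 h
  exact ⟨(ℓ u₀)⁻¹ • u₀, by simp [hu₀]⟩

/-- If the `cᵢ` span `Hom(E, F)` (`ṗ ↦ ∑ ṗᵢ cᵢ` onto) and `ℓ ≠ 0`, then `ṗ ↦ ∑ ṗᵢ (ℓ ∘ cᵢ)` is
onto `E*`: a covector `φ` is `ℓ ∘ (φ ⊗ u)` for any `u` with `ℓ u = 1`. [folklore] -/
theorem surjective_lin_comp {c : ι → E →L[ℝ] F} (hc : Surjective (lin c)) {ℓ : F →L[ℝ] ℝ}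
    (hℓ : ℓ ≠ 0) : Surjective (lin fun i => ℓ.comp (c i)) := by
  obtain ⟨u, hu⟩ := exists_apply_eq_one hℓ
  intro φ
  obtain ⟨q, hq⟩ := hc (φ.smulRight u)
  refine ⟨q, ?_⟩
  rw [lin_apply] at hq ⊢
  have : ∑ i, q i • ℓ.comp (c i) = ℓ.comp (∑ i, q i • c i) := by
    rw [ContinuousLinearMap.comp_finsetSum]
    refine Finset.sum_congr rfl fun i _ => ?_
    rw [ContinuousLinearMap.comp_smul]
  rw [this, hq]
  ext e
  simp [hu]

/-! ### Perturbation by all linear maps: the directions `x ↦ bᵢ x` -/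

/-- The directions "all linear maps": a basis `b` of `Hom(E, F)` read as maps `x ↦ bᵢ x`; their
differentials are the `bᵢ` themselves, which span. [folklore] -/
theorem surjective_lin_fderiv_basis {κ : Type} [Fintype κ] (b : Basis κ ℝ (E →L[ℝ] F)) (x : E) :
    Surjective (lin fun i => fderiv ℝ (fun y => b i y) x) := by
  intro A
  refine ⟨b.equivFun A, ?_⟩
  rw [lin_apply]
  have h : ∀ i, fderiv ℝ (fun y => b i y) x = b i := fun i => (b i).fderiv
  simp only [h]
  exact b.sum_equivFun A

/-- `f + ∑ᵢ (b.equivFun A)ᵢ bᵢ = f + A`. [folklore] -/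
theorem perturb_basis_equivFun {κ : Type} [Fintype κ] (b : Basis κ ℝ (E →L[ℝ] F)) (f : E → F)
    (A : E →L[ℝ] F) :
    perturb f (fun i y => b i y) (b.equivFun A) = fun x => f x + A x := by
  funext x
  rw [perturb_apply]
  congr 1
  conv_rhs => rw [← b.sum_equivFun A]
  rw [_root_.sum_apply]
  rfl

end Calculus

/-! ### The genericity theorems (Sard) -/

section Generic

variable {E F : Type} [NormedAddCommGroup E] [NormedSpace ℝ E] [FiniteDimensional ℝ E]
  [NormedAddCommGroup F] [NormedSpace ℝ F] [FiniteDimensional ℝ F] {ι : Type} [Fintype ι]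

/-! ### Rank never drops to zero: the stratum `{0}` is missed by the dimension count -/

/-- **Thom's theorem below the dimension of the target, for the 1-jet** (Golubitsky–Guillemin
1973, Ch. II Thm. 4.9 with Ch. VI §1, Prop. 1.1: `S_q = {0}` has codimension
`dim Hom(E, F) > dim E` and is generically missed).  If the differentials of the directions `wᵢ`
span `Hom(E, F)` at every point of the open set `Ω` and `dim E < dim Hom(E, F)`, then for almost
every parameter `p` (any additive Haar measure on `ℝᵐ`) the differential of `f + ∑ pᵢ wᵢ`
vanishes at NO point of `Ω`.
[cite: GolubitskyGuillemin1973, Ch. II §4, Thm. 4.9; Ch. VI §1, Prop. 1.1] [cite: HirschDT1976, Ch. 3 §2, Thm. 2.7] -/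
theorem ae_fderiv_perturb_ne_zero (μ : Measure (ι → ℝ)) [μ.IsAddHaarMeasure]
    {f : E → F} {w : ι → E → F} {Ω : Set E} (hΩ : IsOpen Ω)
    (hf : ContDiffOn ℝ ∞ f Ω) (hw : ∀ i, ContDiffOn ℝ ∞ (w i) Ω)
    (hspan : ∀ x ∈ Ω, Surjective (lin fun i => fderiv ℝ (w i) x))
    (hdim : finrank ℝ E < finrank ℝ (E →L[ℝ] F)) :
    ∀ᵐ p ∂μ, ∀ x ∈ Ω, fderiv ℝ (perturb f w p) x ≠ 0 := by
  set G : (ι → ℝ) × E → (E →L[ℝ] F) := fun px => fderiv ℝ (perturb f w px.1) px.2 with hG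
  have hΩ' : IsOpen ((univ : Set (ι → ℝ)) ×ˢ Ω) := isOpen_univ.prod hΩ
  have hGs : ContDiffOn ℝ ∞ G (univ ×ˢ Ω) := contDiffOn_fderiv_perturb hΩ hf hw
  have h₁ : ∀ z ∈ (univ : Set (ι → ℝ)) ×ˢ Ω, G z = 0 →
      Surjective (fderiv ℝ G z ∘L ContinuousLinearMap.inl ℝ (ι → ℝ) E) := by
    intro z hz _
    have hd : HasFDerivAt G (fderiv ℝ G z) z :=
      ((hGs.contDiffAt (hΩ'.mem_nhds hz)).differentiableAt (by simp)).hasFDerivAt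
    rw [← (hasFDerivAt_curry_left hd).fderiv,
      (hasFDerivAt_fderiv_perturb_param hΩ hf hw hz.2 z.1).fderiv]
    exact hspan z.2 hz.2
  have hae := ae_forall_ne_zero_of_finrank_lt μ hΩ' hGs h₁ hdim
  filter_upwards [hae] with p hp x hx
  exact hp x ⟨mem_univ _, hx⟩

/-! ### Transversality of the 1-jet: almost every perturbation -/

/-- **Thom's transversality theorem for the 1-jet and the corank strata, Sard form**
(Golubitsky–Guillemin 1973, Ch. II Thm. 4.9 with Ch. VI Def. 1.5 and Prop. 3.7: one-generic maps
are residual; here: of full measure in the finite-dimensional family).  If the differentials of the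
directions `wᵢ` span `Hom(E, F)` at every point of the open set `Ω`, then for almost every
parameter `p` (any additive Haar measure on `ℝᵐ`) the map `f + ∑ pᵢ wᵢ` is 1-jet-transverse at
EVERY point of `Ω`.  Proof: parametric transversality (Hirsch 1976, Thm. 3.2.7, the tree's
`ParametricTransversality.ae_surjective_fderiv_section`) for the incidence map
`G(p, (x, ℓ)) = ℓ ∘ d(f + ∑ pᵢ wᵢ)_x ∈ E*` on `ℝᵐ × (Ω × (F* ∖ 0))`, whose parameter derivative
`ṗ ↦ ∑ ṗᵢ ℓ ∘ (dwᵢ)_x` is onto (`surjective_lin_comp`), followed by the linear algebra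
`eq_zero_of_surjective_incidence` at each zero.
[cite: GolubitskyGuillemin1973, Ch. II §4, Thm. 4.9; Ch. VI §1, Def. 1.5; Ch. VI §3, Prop. 3.7]
[cite: HirschDT1976, Ch. 3 §2, Thm. 2.7] -/
theorem ae_isOneJetTransverseAt_perturb (μ : Measure (ι → ℝ)) [μ.IsAddHaarMeasure]
    {f : E → F} {w : ι → E → F} {Ω : Set E} (hΩ : IsOpen Ω)
    (hf : ContDiffOn ℝ ∞ f Ω) (hw : ∀ i, ContDiffOn ℝ ∞ (w i) Ω)
    (hspan : ∀ x ∈ Ω, Surjective (lin fun i => fderiv ℝ (w i) x)) :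
    ∀ᵐ p ∂μ, ∀ x ∈ Ω, IsOneJetTransverseAt (perturb f w p) x := by
  -- the incidence map `G(p, (x, ℓ)) = ℓ ∘ d(f + ∑ pᵢ wᵢ)_x`
  set G : (ι → ℝ) × (E × (F →L[ℝ] ℝ)) → (E →L[ℝ] ℝ) :=
    fun z => z.2.2.comp (fderiv ℝ (perturb f w z.1) z.2.1) with hG
  set Ω' : Set ((ι → ℝ) × (E × (F →L[ℝ] ℝ))) := univ ×ˢ (Ω ×ˢ {ℓ | ℓ ≠ 0}) with hΩ'
  have hΩ'o : IsOpen Ω' := isOpen_univ.prod (hΩ.prod isOpen_ne)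
  -- smoothness of `G` on `Ω'`
  have hM : ContDiffOn ℝ ∞ (fun z : (ι → ℝ) × (E × (F →L[ℝ] ℝ)) =>
      fderiv ℝ (perturb f w z.1) z.2.1) Ω' := by
    have hπ : ContDiff ℝ ∞ fun z : (ι → ℝ) × (E × (F →L[ℝ] ℝ)) => (z.1, z.2.1) :=
      contDiff_fst.prodMk (contDiff_fst.comp contDiff_snd)
    refine (contDiffOn_fderiv_perturb hΩ hf hw).comp hπ.contDiffOn ?_
    intro z hz
    exact ⟨mem_univ _, hz.2.1⟩
  have hGs : ContDiffOn ℝ ∞ G Ω' := (contDiff_snd.comp contDiff_snd).contDiffOn.clm_comp hM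
  -- the parameter derivative is onto at every point of `Ω'`
  have h₁ : ∀ z ∈ Ω', G z = 0 →
      Surjective (fderiv ℝ G z ∘L ContinuousLinearMap.inl ℝ (ι → ℝ) (E × (F →L[ℝ] ℝ))) := by
    intro z hz _
    have hd : HasFDerivAt G (fderiv ℝ G z) z :=
      ((hGs.contDiffAt (hΩ'o.mem_nhds hz)).differentiableAt (by simp)).hasFDerivAt
    rw [← (hasFDerivAt_curry_left hd).fderiv]
    -- the section `p ↦ ℓ ∘ (df_x + ∑ pᵢ dwᵢ(x))` is `compL ℓ` after an affine map
    have hsec : HasFDerivAt (fun q : ι → ℝ => G (q, z.2))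
        ((ContinuousLinearMap.compL ℝ E F ℝ z.2.2).comp (lin fun i => fderiv ℝ (w i) z.2.1))
        z.1 :=
      (ContinuousLinearMap.compL ℝ E F ℝ z.2.2).hasFDerivAt.comp z.1
        (hasFDerivAt_fderiv_perturb_param hΩ hf hw hz.2.1 z.1)
    rw [hsec.fderiv]
    have hsurj := surjective_lin_comp (hspan z.2.1 hz.2.1) (ℓ := z.2.2) hz.2.2
    intro φ
    obtain ⟨q, hq⟩ := hsurj φ
    refine ⟨q, ?_⟩
    rw [ContinuousLinearMap.coe_comp, comp_apply, ContinuousLinearMap.compL_apply, ← hq,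
      lin_apply, lin_apply, ContinuousLinearMap.comp_finsetSum]
    refine Finset.sum_congr rfl fun i _ => ?_
    rw [ContinuousLinearMap.comp_smul]
  have hae := ae_surjective_fderiv_section μ hΩ'o hGs h₁
  filter_upwards [hae] with p hp x hx
  intro ℓ hℓ hcomp k hk hv
  have hz : (p, (x, ℓ)) ∈ Ω' := ⟨mem_univ _, hx, hℓ⟩
  have h0 : G (p, (x, ℓ)) = 0 := hcomp
  have hsurj := hp (x, ℓ) hz h0
  -- the derivative of `(x, ℓ) ↦ ℓ ∘ dg_x` at `(x, ℓ)` is `(v, λ) ↦ ℓ ∘ D²g(x) v + λ ∘ dg_x`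
  set g := perturb f w p with hg
  have hgs : ContDiffOn ℝ ∞ g Ω := contDiffOn_perturb hf hw p
  have hg' : ContDiffOn ℝ ∞ (fderiv ℝ g) Ω := hgs.fderiv_of_isOpen hΩ (by simp)
  have hdg : HasFDerivAt (fderiv ℝ g) (fderiv ℝ (fderiv ℝ g) x) x :=
    ((hg'.contDiffAt (hΩ.mem_nhds hx)).differentiableAt (by simp)).hasFDerivAt
  have hd : HasFDerivAt (fun y : E × (F →L[ℝ] ℝ) => fderiv ℝ g y.1)
      ((fderiv ℝ (fderiv ℝ g) x).comp (ContinuousLinearMap.fst ℝ E (F →L[ℝ] ℝ))) (x, ℓ) :=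
    hdg.comp (x, ℓ) hasFDerivAt_fst
  have hc : HasFDerivAt (fun y : E × (F →L[ℝ] ℝ) => y.2)
      (ContinuousLinearMap.snd ℝ E (F →L[ℝ] ℝ)) (x, ℓ) := hasFDerivAt_snd
  have hT := hc.clm_comp hd
  have hTeq : fderiv ℝ (fun y : E × (F →L[ℝ] ℝ) => G (p, y)) (x, ℓ) =
      (ContinuousLinearMap.compL ℝ E F ℝ ℓ).comp
          ((fderiv ℝ (fderiv ℝ g) x).comp (ContinuousLinearMap.fst ℝ E (F →L[ℝ] ℝ))) +
        ((ContinuousLinearMap.compL ℝ E F ℝ).flip (fderiv ℝ g x)).comp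
          (ContinuousLinearMap.snd ℝ E (F →L[ℝ] ℝ)) := hT.fderiv
  rw [hTeq] at hsurj
  refine eq_zero_of_surjective_incidence (g := g) (ℓ := ℓ) ?_ hk hv
  intro φ
  obtain ⟨vl, hvl⟩ := hsurj φ
  refine ⟨vl, ?_⟩
  rw [← hvl]
  simp [ContinuousLinearMap.compL_apply]

/-! ### Both conditions at once; good parameters of small norm -/

/-- For almost every parameter the perturbed map has nowhere-zero differential AND is
1-jet-transverse on `Ω` (GG: the one-generic maps missing `S_q` are residual).
[cite: GolubitskyGuillemin1973, Ch. II §4, Thm. 4.9 and Cor. 4.10; Ch. VI §1, Def. 1.5] -/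
theorem ae_oneGeneric_perturb (μ : Measure (ι → ℝ)) [μ.IsAddHaarMeasure]
    {f : E → F} {w : ι → E → F} {Ω : Set E} (hΩ : IsOpen Ω)
    (hf : ContDiffOn ℝ ∞ f Ω) (hw : ∀ i, ContDiffOn ℝ ∞ (w i) Ω)
    (hspan : ∀ x ∈ Ω, Surjective (lin fun i => fderiv ℝ (w i) x))
    (hdim : finrank ℝ E < finrank ℝ (E →L[ℝ] F)) :
    ∀ᵐ p ∂μ, ∀ x ∈ Ω, fderiv ℝ (perturb f w p) x ≠ 0 ∧ IsOneJetTransverseAt (perturb f w p) x := by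
  filter_upwards [ae_fderiv_perturb_ne_zero μ hΩ hf hw hspan hdim,
    ae_isOneJetTransverseAt_perturb μ hΩ hf hw hspan] with p h1 h2 x hx
  exact ⟨h1 x hx, h2 x hx⟩

/-- **Good perturbations exist arbitrarily close to zero**: for every `ε > 0` some parameter of
norm `< ε` makes `f + ∑ pᵢ wᵢ` have nowhere-zero differential and 1-jet-transverse on `Ω`.
[cite: GolubitskyGuillemin1973, Ch. II §4, Thm. 4.9 (density)] -/
theorem exists_norm_lt_oneGeneric_perturb {f : E → F} {w : ι → E → F} {Ω : Set E} (hΩ : IsOpen Ω)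
    (hf : ContDiffOn ℝ ∞ f Ω) (hw : ∀ i, ContDiffOn ℝ ∞ (w i) Ω)
    (hspan : ∀ x ∈ Ω, Surjective (lin fun i => fderiv ℝ (w i) x))
    (hdim : finrank ℝ E < finrank ℝ (E →L[ℝ] F)) {ε : ℝ} (hε : 0 < ε) :
    ∃ p : ι → ℝ, ‖p‖ < ε ∧
      ∀ x ∈ Ω, fderiv ℝ (perturb f w p) x ≠ 0 ∧ IsOneJetTransverseAt (perturb f w p) x :=
  exists_norm_lt_of_ae (volume : Measure (ι → ℝ))
    (ae_oneGeneric_perturb volume hΩ hf hw hspan hdim) hε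

/-! ### Perturbation by an arbitrary linear map: the headline statements -/

/-- **First-order genericity after almost every linear perturbation** (Thom; Golubitsky–Guillemin
1973, Ch. II Thm. 4.9, Ch. VI §1 Def. 1.5 and Prop. 1.1, §3 Prop. 3.7; the form of B–S's *"a
special case of Thom's transversality"*, arXiv:1705.11169 §2.1 p. 6, at first order).  Let
`f : E → F` be `C^∞` on the open set `Ω`, `dim E < dim Hom(E, F)`.  Then for almost every linear
map `A : E → F` — with respect to ANY additive Haar measure on `Hom(E, F)` — the map `f + A` has
nowhere-vanishing differential on `Ω` and is 1-jet-transverse at every point of `Ω`.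
[cite: GolubitskyGuillemin1973, Ch. II §4, Thm. 4.9; Ch. VI §1, Def. 1.5; Ch. VI §3, Prop. 3.7]
[cite: HirschDT1976, Ch. 3 §2, Thm. 2.7] [cite: BaykurSaeki2017, §2.1, p. 6] -/
theorem ae_oneGeneric_add (μ : Measure (E →L[ℝ] F)) [μ.IsAddHaarMeasure]
    {f : E → F} {Ω : Set E} (hΩ : IsOpen Ω) (hf : ContDiffOn ℝ ∞ f Ω)
    (hdim : finrank ℝ E < finrank ℝ (E →L[ℝ] F)) :
    ∀ᵐ A ∂μ, ∀ x ∈ Ω, fderiv ℝ (fun y => f y + A y) x ≠ 0 ∧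
      IsOneJetTransverseAt (fun y => f y + A y) x := by
  set b := Module.finBasis ℝ (E →L[ℝ] F) with hb
  set T : (E →L[ℝ] F) ≃L[ℝ] (Fin (finrank ℝ (E →L[ℝ] F)) → ℝ) := b.equivFunL with hT
  haveI : (Measure.map T μ).IsAddHaarMeasure := T.isAddHaarMeasure_map μ
  have hw : ∀ i, ContDiffOn ℝ ∞ (fun y : E => b i y) Ω := fun i => (b i).contDiff.contDiffOn
  have hae := ae_oneGeneric_perturb (Measure.map T μ) hΩ hf hw
    (fun x _ => surjective_lin_fderiv_basis b x) hdim
  have hae' := ae_of_ae_map T.continuous.measurable.aemeasurable hae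
  filter_upwards [hae'] with A hA
  have heq : perturb f (fun i y => b i y) (T A) = fun y => f y + A y := by
    rw [hT]
    exact perturb_basis_equivFun b f A
  rw [heq] at hA
  exact hA

/-- **Small generic linear perturbations exist**: for every `ε > 0` there is a linear map `A`
with `‖A‖ < ε` such that `f + A` has nowhere-vanishing differential and is 1-jet-transverse on
`Ω` (GG II.4.9: density of the one-generic maps, in the strong form "by an arbitrarily small
LINEAR perturbation" of the finite-dimensional proof).
[cite: GolubitskyGuillemin1973, Ch. II §4, Thm. 4.9; Ch. VI §1, Def. 1.5] -/
theorem exists_opNorm_lt_oneGeneric {f : E → F} {Ω : Set E} (hΩ : IsOpen Ω)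
    (hf : ContDiffOn ℝ ∞ f Ω) (hdim : finrank ℝ E < finrank ℝ (E →L[ℝ] F)) {ε : ℝ} (hε : 0 < ε) :
    ∃ A : E →L[ℝ] F, ‖A‖ < ε ∧ ∀ x ∈ Ω, fderiv ℝ (fun y => f y + A y) x ≠ 0 ∧
      IsOneJetTransverseAt (fun y => f y + A y) x := by
  set b := Module.finBasis ℝ (E →L[ℝ] F) with hb
  set T : (E →L[ℝ] F) ≃L[ℝ] (Fin (finrank ℝ (E →L[ℝ] F)) → ℝ) := b.equivFunL with hT
  -- an additive Haar measure on `Hom(E, F)`: push Lebesgue measure back through `T`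
  set μ : Measure (E →L[ℝ] F) := Measure.map T.symm volume with hμ
  haveI : μ.IsAddHaarMeasure := T.symm.isAddHaarMeasure_map volume
  exact exists_norm_lt_of_ae μ (ae_oneGeneric_add μ hΩ hf hdim) hε

/-! ### The case of maps from 4-space to the plane -/

omit [FiniteDimensional ℝ F] in
/-- If `E ≠ 0` and `dim F ≥ 2` then `dim E < dim Hom(E, F)` — the dimension hypothesis of the
genericity theorems holds for maps to the plane (and beyond) from any positive-dimensional space
(`dim Hom(E, F) = dim E · dim F`, the tree's `finrank_continuousLinearMap_real`). [folklore] -/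
theorem finrank_lt_finrank_continuousLinearMap (hE : 0 < finrank ℝ E) (hF : 2 ≤ finrank ℝ F) :
    finrank ℝ E < finrank ℝ (E →L[ℝ] F) := by
  rw [finrank_continuousLinearMap_real]
  nlinarith

/-- Local notation for this file: the model space `ℝⁿ = EuclideanSpace ℝ (Fin n)`. -/
local notation "𝔼 " n:arg => EuclideanSpace ℝ (Fin n)

/-- `dim ℝ⁴ = 4 < 8 = dim Hom(ℝ⁴, ℝ²)`. [folklore] -/
theorem finrank_euclideanFour_lt : finrank ℝ (𝔼 4) < finrank ℝ ((𝔼 4) →L[ℝ] 𝔼 2) :=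
  finrank_lt_finrank_continuousLinearMap (by simp) (by simp)

/-- **Maps from 4-space to the plane are first-order generic after an arbitrarily small linear
perturbation** — the first-order part of "generic" in Baykur–Saeki §2.1 (arXiv:1705.11169, p. 6:
Thom's transversality, [Lev0, T, Wh]): for `f : ℝ⁴ ⊇ Ω → ℝ²` of class `C^∞` on the open set `Ω`
and `ε > 0` there is a linear `A` with `‖A‖ < ε` such that `g = f + A` has `dg_x ≠ 0` (rank `≥ 1`)
at every `x ∈ Ω` and `j¹g ⋔ S₁` at every critical point in `Ω` (in the covector reading
`IsOneJetTransverseAt`, which at a rank-one point of a map to the plane is Golubitsky–Guillemin's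
VI.3.7).  At such a critical point `x`, with `ℓ` the cokernel covector: either the kernel Hessian
`ℓ ∘ D²g(x)|_{Ker × Ker}` is nondegenerate — a fold point (GG III Def. 4.1 / VI (2.1)(a)), for
which, when indefinite, the tree's `hasIndefiniteFoldChart_of_kerHessian` supplies B–S's normal form
`(t, x₁² + x₂² - x₃²)` — or it is degenerate (a cusp candidate, VI (2.1)(b)); the second-order
genericity of the latter is the next brick.
[cite: BaykurSaeki2017, §2.1, p. 6] [cite: GolubitskyGuillemin1973, Ch. II §4, Thm. 4.9; Ch. VI §1, Def. 1.5; Ch. VI §3, Prop. 3.7] -/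
theorem exists_opNorm_lt_oneGeneric_four_two {f : (𝔼 4) → 𝔼 2} {Ω : Set (𝔼 4)} (hΩ : IsOpen Ω)
    (hf : ContDiffOn ℝ ∞ f Ω) {ε : ℝ} (hε : 0 < ε) :
    ∃ A : ((𝔼 4) →L[ℝ] (𝔼 2)), ‖A‖ < ε ∧ ∀ x ∈ Ω, fderiv ℝ (fun y => f y + A y) x ≠ 0 ∧
      IsOneJetTransverseAt (fun y => f y + A y) x :=
  exists_opNorm_lt_oneGeneric hΩ hf finrank_euclideanFour_lt hε

end Generic

end OneJet

end Literature.Topology.FourManifolds
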